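import Summits.ValiantsHypothesis.ValiantsHypothesis.Theorems.GrenetZeonDualUnipotentThreeHalvesLongMassNilSpaceSandwich

/-!
# `GrenetZeon.DualUnipotentThreeHalves` (stmt-ValiantsHypothesis-24318), line `slow_core`, stub (c) `SlowCore.LongMassSlowLawInv`:
# TOP-IMAGE LAWS of a nilpotent matrix space (de Seguins Pazzis 2019, §2) — transport, top-span, reducibility

The research statement (c) quantifies (✓ `longMassSlowLawInv_iff_submodule`) over all linear spaces `V ≤ M_b(ℂ)` of nilpotent
matrices, and a violator is WLOG irreducible (✓ `LongMassIrreducibilityFree.inv_iff_all`, V34 §2).  ✓ `NilSpaceSandwich` gave the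
ONE-LETTER identity `Σ_{i<H} A^i B A^{H−1−i} = 0` and the sandwich `A^{H−1} B A^{H−1} = 0`.  This file extracts from the one-letter
identity the TRANSPORT LAWS behind C. de Seguins Pazzis' analysis of the spaces `im u^{p−1}` (*The structured Gerstenhaber problem
(II)*, Linear Algebra Appl. 2019, arXiv:1806.11355, §2.2–2.3), in the submodule currency of (c).  Throughout `V ≤ M_b(ℂ)` with `X ^ H = 0`
for every `X ∈ V` (`1 ≤ H`), `A, B ∈ V`, and `u₁(A,B) := Σ_{i<H−1} A^i B A^{H−2−i}` (the `t`-derivative of `(A + tB)^{H−1}`):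

* §1 TRANSPORT (pure algebra): `mul_top_eq` — `B · A^{H−1} = −A · u₁(A,B)`; `top_mul_eq` — `A^{H−1} · B = −u₁(A,B) · A`;
  `pow_mul_top_eq` — `A^j · B · A^{H−1} = −A^{j+1} · Σ_{i<H−1−j} A^i B A^{H−2−i}`.  Hence (`exists_mulVec_top_eq`,
  `top_mulVec_eq_zero_of_mulVec_eq_zero`, `exists_pow_mulVec_top_eq`): every `B ∈ V` maps `range A^{H−1}` into `range A`, maps `ker A` into
  `ker A^{H−1}`, and `A^j · B · range A^{H−1} ⊆ range A^{j+1}` for every `j`.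
* §2 TOP-SPAN LAW (dSP Prop. 2.2): for EVERY subspace `K ≤ ℂ^b` containing all top images `X^{H−1} y` (`X ∈ V`):
  `u₁(A,B) y ∈ K` (`derivSum_mulVec_mem`: the vector polynomial `t ↦ (A+tB)^{H−1} y` takes values in `K`, so its `t`-coefficient does —
  read off through `ℂ[X] → ℂ[ε]/ε²` and ✓ `dualLift_pow_map_snd`, separated by `Subspace.dualAnnihilator_dualCoannihilator_eq`), hence
  `B (A^{H−1} y) = A z` with `z ∈ K` (`exists_mem_mulVec_top_eq`): `B · range A^{H−1} ⊆ A · K`.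
* §3 REDUCIBILITY LEMMA (dSP Lemma 2.5): if some top vector `x = A^{H−1} y₀` satisfies `K ⊆ ℂx + V·x` for such a `K`, then `V·x = 0`
  (`mulVec_eq_zero_of_topSpan_le`; induction `K ⊆ range A^k`, `k ≤ H−1`); so (`not_topSpan_le_of_irreducible`) in an IRREDUCIBLE nilpotent
  space with `b ≥ 2` NO nonzero top vector `x` has `K ⊆ ℂx + V·x` — a law every (c)-violator satisfies at every element of maximal index.

HONEST FRAMING.  Support lemmas (`--supports stmt-ValiantsHypothesis-24318`); NOT progress on (c) `SlowCore.LongMassSlowLawInv`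
(RESEARCH — OPEN); closes no stub; S3, the crux 24318, 8062 (`stub_dualUnipotent`) and `VP ≠ VNP` are NOT proved.  Def-free (the top span
`K(V)` enters only through the hypothesis «`K` contains every `X^{H−1} y`»), no named facts, no sorry.
[cite: deSeguinsPazzis2019StructuredGerstenhaberII, Prop. 2.2 and Lemma 2.5] (C. de Seguins Pazzis, The structured Gerstenhaber problem (II), LAA 569 (2019), arXiv:1806.11355)
-/

set_option linter.dupNamespace false
set_option autoImplicit false

noncomputable section

namespace Summit.ValiantsHypothesis.ValiantsHypothesis.Theorems.GrenetZeon.NilSpaceTopImage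

open Matrix Polynomial TrivSqZeroExt
open scoped BigOperators
open Summit.ValiantsHypothesis.ValiantsHypothesis.Cruxes.TwoDimCoefficients.DimTwoCases.DualCharpoly
  (dualLift_pow_map_snd)
open Summit.ValiantsHypothesis.ValiantsHypothesis.Theorems.GrenetZeon.NilSpaceSandwich
  (oneLetter_eq_zero evalRingHom_mapMatrix_line aeval_eps_mapMatrix_line)

variable {b : ℕ}

/-! ## §1 Transport laws from the one-letter identity -/

/-- Splitting the one-letter sum after a left shift by `A^j`: the terms `i ≥ H − j` die (`A^H = 0`), the term `i = 0`... precisely,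
`Σ_{i<H} A^{j+i} B A^{H−1−i} = A^j B A^{H−1} + A^{j+1} · Σ_{i<H−1−j} A^i B A^{H−2−i}` when `A^H = 0`, `j + 1 ≤ H`. -/
theorem pow_mul_oneLetter_eq {A B : Matrix (Fin b) (Fin b) ℂ} {H : ℕ} (hA : A ^ H = 0) {j : ℕ} (hj : j + 1 ≤ H) :
    A ^ j * (∑ i ∈ Finset.range H, A ^ i * B * A ^ (H - 1 - i)) =
      A ^ j * B * A ^ (H - 1) + A ^ (j + 1) * (∑ i ∈ Finset.range (H - 1 - j), A ^ i * B * A ^ (H - 2 - i)) := by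
  rw [Finset.mul_sum]
  -- split `range H` at `H - j`: indices `i < H - j` survive, the rest die
  have hsplit : (∑ i ∈ Finset.range H, A ^ j * (A ^ i * B * A ^ (H - 1 - i))) =
      ∑ i ∈ Finset.range (H - j), A ^ j * (A ^ i * B * A ^ (H - 1 - i)) := by
    have hHj : H - j ≤ H := Nat.sub_le _ _
    rw [← Finset.sum_range_add_sum_Ico _ hHj]
    rw [Finset.sum_eq_zero (s := Finset.Ico (H - j) H), add_zero]
    intro i hi
    have hi' : H - j ≤ i := (Finset.mem_Ico.mp hi).1
    have e : j + i = H + (i + j - H) := by omega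
    rw [← Matrix.mul_assoc, ← Matrix.mul_assoc, ← pow_add, e, pow_add, hA, Matrix.zero_mul, Matrix.zero_mul,
      Matrix.zero_mul]
  rw [hsplit]
  have hHj : H - j = (H - 1 - j) + 1 := by omega
  rw [hHj, Finset.sum_range_succ', Finset.mul_sum]
  rw [add_comm]
  congr 1
  · rw [pow_zero, Matrix.one_mul, Nat.sub_zero, Matrix.mul_assoc]
  · refine Finset.sum_congr rfl fun i hi => ?_
    have hi' := Finset.mem_range.mp hi
    have e1 : H - 1 - (i + 1) = H - 2 - i := by omega
    rw [e1, pow_succ, pow_succ]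
    simp only [Matrix.mul_assoc]
    rw [← Matrix.mul_assoc (A ^ i), ← pow_succ, ← Matrix.mul_assoc A, ← pow_succ', pow_succ]

/-- ★ **GENERAL TRANSPORT LAW.**  In a nilpotent space of uniform index `≤ H`, for `A, B ∈ V` and `j + 1 ≤ H`:
`A^j · B · A^{H−1} = −A^{j+1} · Σ_{i<H−1−j} A^i B A^{H−2−i}` — every `B ∈ V` maps `range A^{H−1}` into `(A^j)⁻¹(range A^{j+1})`.
[cite: deSeguinsPazzis2019StructuredGerstenhaberII, Prop. 2.2 (proof)] -/
theorem pow_mul_top_eq (V : Submodule ℂ (Matrix (Fin b) (Fin b) ℂ)) {H : ℕ} (hV : ∀ X ∈ V, X ^ H = 0)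
    {A B : Matrix (Fin b) (Fin b) ℂ} (hA : A ∈ V) (hB : B ∈ V) {j : ℕ} (hj : j + 1 ≤ H) :
    A ^ j * B * A ^ (H - 1) = -(A ^ (j + 1) * (∑ i ∈ Finset.range (H - 1 - j), A ^ i * B * A ^ (H - 2 - i))) := by
  have h0 := oneLetter_eq_zero V hV hA hB
  have h1 := pow_mul_oneLetter_eq (B := B) (hV A hA) hj
  rw [h0, Matrix.mul_zero] at h1
  exact eq_neg_of_add_eq_zero_left h1.symm

/-- ★ **RANGE TRANSPORT** (`j = 0`): `B · A^{H−1} = −A · u₁(A,B)` with `u₁(A,B) = Σ_{i<H−1} A^i B A^{H−2−i}`; so `B · range A^{H−1} ⊆ range A`.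
[cite: deSeguinsPazzis2019StructuredGerstenhaberII, Prop. 2.2] -/
theorem mul_top_eq (V : Submodule ℂ (Matrix (Fin b) (Fin b) ℂ)) {H : ℕ} (hV : ∀ X ∈ V, X ^ H = 0) (hH : 1 ≤ H)
    {A B : Matrix (Fin b) (Fin b) ℂ} (hA : A ∈ V) (hB : B ∈ V) :
    B * A ^ (H - 1) = -(A * (∑ i ∈ Finset.range (H - 1), A ^ i * B * A ^ (H - 2 - i))) := by
  have h := pow_mul_top_eq V hV hA hB (j := 0) (by omega)
  simpa using h

/-- Right-shifted splitting: `(Σ_{i<H} A^i B A^{H−1−i}) · A = (Σ_{i<H−1} A^i B A^{H−2−i}) · A² …` — precisely, when `A^H = 0` and `1 ≤ H`,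
`(Σ_{i<H} A^i B A^{H−1−i}) = A^{H−1} · B + (Σ_{i<H−1} A^i B A^{H−2−i}) · A`. -/
theorem oneLetter_eq_top_mul_add {A B : Matrix (Fin b) (Fin b) ℂ} {H : ℕ} (hH : 1 ≤ H) :
    (∑ i ∈ Finset.range H, A ^ i * B * A ^ (H - 1 - i)) =
      A ^ (H - 1) * B + (∑ i ∈ Finset.range (H - 1), A ^ i * B * A ^ (H - 2 - i)) * A := by
  obtain ⟨H', rfl⟩ : ∃ H', H = H' + 1 := ⟨H - 1, by omega⟩
  rw [Finset.sum_range_succ]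
  simp only [Nat.add_sub_cancel, Nat.sub_self, pow_zero, Matrix.mul_one]
  rw [add_comm, Finset.sum_mul]
  congr 1
  refine Finset.sum_congr rfl fun i hi => ?_
  have hi' := Finset.mem_range.mp hi
  have e : H' - i = (H' + 1 - 2 - i) + 1 := by omega
  rw [e, pow_succ]
  simp only [Matrix.mul_assoc]

/-- ★ **KERNEL TRANSPORT**: `A^{H−1} · B = −u₁(A,B) · A`; so every `B ∈ V` maps `ker A` into `ker A^{H−1}`.
[cite: deSeguinsPazzis2019StructuredGerstenhaberII, §2.2] -/
theorem top_mul_eq (V : Submodule ℂ (Matrix (Fin b) (Fin b) ℂ)) {H : ℕ} (hV : ∀ X ∈ V, X ^ H = 0) (hH : 1 ≤ H)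
    {A B : Matrix (Fin b) (Fin b) ℂ} (hA : A ∈ V) (hB : B ∈ V) :
    A ^ (H - 1) * B = -((∑ i ∈ Finset.range (H - 1), A ^ i * B * A ^ (H - 2 - i)) * A) := by
  have h0 := oneLetter_eq_zero V hV hA hB
  rw [oneLetter_eq_top_mul_add hH] at h0
  exact eq_neg_of_add_eq_zero_left h0

/-- Every `B ∈ V` maps `range A^{H−1}` into `range A`: `B (A^{H−1} y) = A z` for some `z`. -/
theorem exists_mulVec_top_eq (V : Submodule ℂ (Matrix (Fin b) (Fin b) ℂ)) {H : ℕ} (hV : ∀ X ∈ V, X ^ H = 0) (hH : 1 ≤ H)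
    {A B : Matrix (Fin b) (Fin b) ℂ} (hA : A ∈ V) (hB : B ∈ V) (y : Fin b → ℂ) :
    ∃ z : Fin b → ℂ, B *ᵥ (A ^ (H - 1) *ᵥ y) = A *ᵥ z := by
  refine ⟨-((∑ i ∈ Finset.range (H - 1), A ^ i * B * A ^ (H - 2 - i)) *ᵥ y), ?_⟩
  rw [Matrix.mulVec_mulVec, mul_top_eq V hV hH hA hB, Matrix.neg_mulVec, Matrix.mulVec_neg, Matrix.mulVec_mulVec]

/-- Every `B ∈ V` maps `ker A` into `ker A^{H−1}`. -/
theorem top_mulVec_eq_zero_of_mulVec_eq_zero (V : Submodule ℂ (Matrix (Fin b) (Fin b) ℂ)) {H : ℕ} (hV : ∀ X ∈ V, X ^ H = 0)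
    (hH : 1 ≤ H) {A B : Matrix (Fin b) (Fin b) ℂ} (hA : A ∈ V) (hB : B ∈ V) {w : Fin b → ℂ} (hw : A *ᵥ w = 0) :
    A ^ (H - 1) *ᵥ (B *ᵥ w) = 0 := by
  rw [Matrix.mulVec_mulVec, top_mul_eq V hV hH hA hB, Matrix.neg_mulVec, ← Matrix.mulVec_mulVec, hw, Matrix.mulVec_zero,
    neg_zero]

/-- General form: `A^j (B (A^{H−1} y)) = A^{j+1} z` for some `z`, for every `j + 1 ≤ H`. -/
theorem exists_pow_mulVec_top_eq (V : Submodule ℂ (Matrix (Fin b) (Fin b) ℂ)) {H : ℕ} (hV : ∀ X ∈ V, X ^ H = 0)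
    {A B : Matrix (Fin b) (Fin b) ℂ} (hA : A ∈ V) (hB : B ∈ V) {j : ℕ} (hj : j + 1 ≤ H) (y : Fin b → ℂ) :
    ∃ z : Fin b → ℂ, A ^ j *ᵥ (B *ᵥ (A ^ (H - 1) *ᵥ y)) = A ^ (j + 1) *ᵥ z := by
  refine ⟨-((∑ i ∈ Finset.range (H - 1 - j), A ^ i * B * A ^ (H - 2 - i)) *ᵥ y), ?_⟩
  rw [Matrix.mulVec_mulVec, Matrix.mulVec_mulVec, pow_mul_top_eq V hV hA hB hj, Matrix.neg_mulVec, Matrix.mulVec_neg,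
    Matrix.mulVec_mulVec]

/-- The two transport laws combined with the sandwich: `B` maps `range A^{H−1}` into `range A ∩ ker A^{H−1}`. -/
theorem exists_mulVec_top_eq_and_top_mulVec_eq_zero (V : Submodule ℂ (Matrix (Fin b) (Fin b) ℂ)) {H : ℕ}
    (hV : ∀ X ∈ V, X ^ H = 0) (hH : 1 ≤ H) {A B : Matrix (Fin b) (Fin b) ℂ} (hA : A ∈ V) (hB : B ∈ V) (y : Fin b → ℂ) :
    (∃ z : Fin b → ℂ, B *ᵥ (A ^ (H - 1) *ᵥ y) = A *ᵥ z) ∧ A ^ (H - 1) *ᵥ (B *ᵥ (A ^ (H - 1) *ᵥ y)) = 0 := by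
  refine ⟨exists_mulVec_top_eq V hV hH hA hB y, ?_⟩
  rw [Matrix.mulVec_mulVec, Matrix.mulVec_mulVec,
    Summit.ValiantsHypothesis.ValiantsHypothesis.Theorems.GrenetZeon.NilSpaceSandwich.sandwich_eq_zero V hV hH hA hB,
    Matrix.zero_mulVec]

/-! ## §2 The top-span law (de Seguins Pazzis 2019, Prop. 2.2) -/

/-- `ε`-parts commute with `mulVec` against an `ε`-free vector. -/
theorem snd_mulVec_inl (D : Matrix (Fin b) (Fin b) (DualNumber ℂ)) (y : Fin b → ℂ) (i : Fin b) :
    snd ((D *ᵥ fun j => (inl (y j) : DualNumber ℂ)) i) = ((D.map (snd : DualNumber ℂ → ℂ)) *ᵥ y) i := by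
  simp only [Matrix.mulVec, dotProduct, TrivSqZeroExt.snd_sum, DualNumber.snd_mul, snd_inl, fst_inl, mul_zero, zero_add,
    Matrix.map_apply]

/-- ★ **COEFFICIENT EXTRACTION.**  If a subspace `K ≤ ℂ^b` contains `(A + t·B)^{H−1} y` for every `t ∈ ℂ`, then it contains the
`t`-derivative `u₁(A,B)·y = (Σ_{i<H−1} A^i B A^{H−2−i})·y` (a vector polynomial with all values in `K` has its coefficients in `K`:
separate by a functional `φ` killing `K`, get a polynomial `f ∈ ℂ[X]` vanishing on `ℂ`, hence `f = 0`, and read the `X`-coefficient through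
`ℂ[X] → ℂ[ε]/ε²` with ✓ `dualLift_pow_map_snd`). [cite: deSeguinsPazzis2019StructuredGerstenhaberII, Prop. 2.2 (proof)] -/
theorem derivSum_mulVec_mem_of_forall_line {A B : Matrix (Fin b) (Fin b) ℂ} {H : ℕ} (K : Submodule ℂ (Fin b → ℂ)) (y : Fin b → ℂ)
    (h : ∀ t : ℂ, (A + t • B) ^ (H - 1) *ᵥ y ∈ K) :
    (∑ i ∈ Finset.range (H - 1), A ^ i * B * A ^ (H - 2 - i)) *ᵥ y ∈ K := by
  classical
  rw [← Subspace.forall_mem_dualAnnihilator_apply_eq_zero_iff]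
  intro φ hφ
  rw [Submodule.mem_dualAnnihilator] at hφ
  -- coordinates of `φ`
  set a : Fin b → ℂ := fun i => φ (fun j => if i = j then 1 else 0) with ha
  have hφc : ∀ w : Fin b → ℂ, φ w = ∑ i, w i * a i := fun w => by
    rw [LinearMap.pi_apply_eq_sum_univ]
    simp only [smul_eq_mul, ha]
  -- the line and the vector polynomial
  set L : Matrix (Fin b) (Fin b) ℂ[X] := A.map Polynomial.C + (Polynomial.X : ℂ[X]) • B.map Polynomial.C with hL
  set P : Fin b → ℂ[X] := (L ^ (H - 1)) *ᵥ (fun j => Polynomial.C (y j)) with hP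
  set f : ℂ[X] := ∑ i, P i * Polynomial.C (a i) with hf
  have hevP : ∀ (t : ℂ) (i : Fin b), (Polynomial.evalRingHom t) (P i) = (((A + t • B) ^ (H - 1)) *ᵥ y) i := by
    intro t i
    rw [hP, RingHom.map_mulVec, ← RingHom.mapMatrix_apply, map_pow, hL, evalRingHom_mapMatrix_line]
    have e : ((Polynomial.evalRingHom t : ℂ[X] → ℂ) ∘ fun j => Polynomial.C (y j)) = y := by
      funext j
      simp
    rw [e]
  have hf0 : f = 0 := by
    apply Polynomial.funext
    intro t
    rw [Polynomial.eval_zero, hf, ← Polynomial.coe_evalRingHom, map_sum]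
    simp only [map_mul, hevP, Polynomial.coe_evalRingHom, Polynomial.eval_C]
    rw [← hφc]
    exact hφ _ (h t)
  -- push along `X ↦ ε`
  set ψ : ℂ[X] →+* DualNumber ℂ :=
    ((Polynomial.aeval (DualNumber.eps : DualNumber ℂ) : ℂ[X] →ₐ[ℂ] DualNumber ℂ) : ℂ[X] →+* DualNumber ℂ) with hψ
  have hψC : ∀ c : ℂ, ψ (Polynomial.C c) = inl c := fun c => by
    rw [hψ]
    simp [TrivSqZeroExt.algebraMap_eq_inl]
  have hψP : ∀ i : Fin b, snd (ψ (P i)) = ((∑ i ∈ Finset.range (H - 1), A ^ i * B * A ^ (H - 2 - i)) *ᵥ y) i := by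
    intro i
    have hd := dualLift_pow_map_snd A B (H - 1)
    rw [show H - 1 - 1 = H - 2 from by omega] at hd
    rw [hP, RingHom.map_mulVec, ← RingHom.mapMatrix_apply, map_pow, hψ, aeval_eps_mapMatrix_line, ← hd]
    have e : ((((Polynomial.aeval (DualNumber.eps : DualNumber ℂ) : ℂ[X] →ₐ[ℂ] DualNumber ℂ) : ℂ[X] →+* DualNumber ℂ) : ℂ[X] → DualNumber ℂ) ∘
        fun j => Polynomial.C (y j)) = fun j => (inl (y j) : DualNumber ℂ) := by
      funext j
      simp only [Function.comp_apply]
      rw [← hψ]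
      exact hψC (y j)
    rw [e, snd_mulVec_inl]
  have hsnd : snd (ψ f) = φ ((∑ i ∈ Finset.range (H - 1), A ^ i * B * A ^ (H - 2 - i)) *ᵥ y) := by
    rw [hf, map_sum, TrivSqZeroExt.snd_sum]
    simp only [map_mul, hψC, DualNumber.snd_mul, snd_inl, fst_inl, mul_zero, zero_add, hψP]
    rw [hφc]
  rw [← hsnd, hf0, map_zero, snd_zero]

/-- ★★ **TOP-SPAN LAW** (dSP Prop. 2.2, first half).  In a nilpotent space `V` of uniform index `≤ H`, for every subspace `K ≤ ℂ^b`
containing all top images `X^{H−1} y` (`X ∈ V`), and all `A, B ∈ V`, `y`: `u₁(A,B)·y ∈ K`. [cite: deSeguinsPazzis2019StructuredGerstenhaberII, Prop. 2.2] -/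
theorem derivSum_mulVec_mem (V : Submodule ℂ (Matrix (Fin b) (Fin b) ℂ)) {H : ℕ}
    (K : Submodule ℂ (Fin b → ℂ)) (hK : ∀ X ∈ V, ∀ y : Fin b → ℂ, X ^ (H - 1) *ᵥ y ∈ K)
    {A B : Matrix (Fin b) (Fin b) ℂ} (hA : A ∈ V) (hB : B ∈ V) (y : Fin b → ℂ) :
    (∑ i ∈ Finset.range (H - 1), A ^ i * B * A ^ (H - 2 - i)) *ᵥ y ∈ K :=
  derivSum_mulVec_mem_of_forall_line K y fun t => hK _ (V.add_mem hA (V.smul_mem t hB)) y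

/-- ★★ **TOP-SPAN LAW** (dSP Prop. 2.2): `B (A^{H−1} y) = A z` with `z ∈ K` — every member of `V` maps the top images of `A` into
`A·K(V)`, for every `K` containing all top images (`1 ≤ H`). [cite: deSeguinsPazzis2019StructuredGerstenhaberII, Prop. 2.2] -/
theorem exists_mem_mulVec_top_eq (V : Submodule ℂ (Matrix (Fin b) (Fin b) ℂ)) {H : ℕ} (hV : ∀ X ∈ V, X ^ H = 0) (hH : 1 ≤ H)
    (K : Submodule ℂ (Fin b → ℂ)) (hK : ∀ X ∈ V, ∀ y : Fin b → ℂ, X ^ (H - 1) *ᵥ y ∈ K)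
    {A B : Matrix (Fin b) (Fin b) ℂ} (hA : A ∈ V) (hB : B ∈ V) (y : Fin b → ℂ) :
    ∃ z ∈ K, B *ᵥ (A ^ (H - 1) *ᵥ y) = A *ᵥ z := by
  refine ⟨-((∑ i ∈ Finset.range (H - 1), A ^ i * B * A ^ (H - 2 - i)) *ᵥ y),
    K.neg_mem (derivSum_mulVec_mem V K hK hA hB y), ?_⟩
  rw [Matrix.mulVec_mulVec, mul_top_eq V hV hH hA hB, Matrix.neg_mulVec, Matrix.mulVec_neg, Matrix.mulVec_mulVec]

/-! ## §3 The Reducibility Lemma (de Seguins Pazzis 2019, Lemma 2.5) -/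

/-- Under condition (C) «`K ⊆ ℂx + V·x`» for a top vector `x = A^{H−1} y₀`, the top span climbs the range filtration of `A`:
`K ⊆ range A^k` for every `k ≤ H − 1`. [cite: deSeguinsPazzis2019StructuredGerstenhaberII, Lemma 2.5 (proof)] -/
theorem exists_eq_pow_mulVec_of_topSpan_le (V : Submodule ℂ (Matrix (Fin b) (Fin b) ℂ)) {H : ℕ} (hV : ∀ X ∈ V, X ^ H = 0)
    (hH : 1 ≤ H) (K : Submodule ℂ (Fin b → ℂ)) (hK : ∀ X ∈ V, ∀ y : Fin b → ℂ, X ^ (H - 1) *ᵥ y ∈ K)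
    {A : Matrix (Fin b) (Fin b) ℂ} (hA : A ∈ V) (y₀ : Fin b → ℂ)
    (hC : ∀ w ∈ K, ∃ (c : ℂ) (X : Matrix (Fin b) (Fin b) ℂ), X ∈ V ∧
      w = c • (A ^ (H - 1) *ᵥ y₀) + X *ᵥ (A ^ (H - 1) *ᵥ y₀)) :
    ∀ k, k ≤ H - 1 → ∀ w ∈ K, ∃ z : Fin b → ℂ, w = A ^ k *ᵥ z := by
  intro k
  induction k with
  | zero =>
    intro _ w _
    exact ⟨w, by rw [pow_zero, Matrix.one_mulVec]⟩
  | succ k ih =>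
    intro hk w hw
    obtain ⟨c, X, hX, hw'⟩ := hC w hw
    obtain ⟨z, hzK, hz⟩ := exists_mem_mulVec_top_eq V hV hH K hK hA hX y₀
    obtain ⟨z', hz'⟩ := ih (by omega) z hzK
    refine ⟨c • (A ^ (H - 1 - (k + 1)) *ᵥ y₀) + z', ?_⟩
    rw [hw', hz, hz']
    simp only [Matrix.mulVec_add, Matrix.mulVec_smul, Matrix.mulVec_mulVec, ← pow_succ', ← pow_add]
    rw [show k + 1 + (H - 1 - (k + 1)) = H - 1 from by omega]

/-- ★★★ **REDUCIBILITY LEMMA** (dSP Lemma 2.5).  In a nilpotent space `V` of uniform index `≤ H` (`1 ≤ H`), let `K` contain all top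
images and let `x = A^{H−1} y₀` (`A ∈ V`) satisfy (C) «every `w ∈ K` is `c·x + X·x` for some `c ∈ ℂ`, `X ∈ V`».  Then `V·x = 0`:
`x` is a common kernel vector of `V` (so `ℂx` is a common invariant line whenever `x ≠ 0`). [cite: deSeguinsPazzis2019StructuredGerstenhaberII, Lemma 2.5] -/
theorem mulVec_top_eq_zero_of_topSpan_le (V : Submodule ℂ (Matrix (Fin b) (Fin b) ℂ)) {H : ℕ} (hV : ∀ X ∈ V, X ^ H = 0)
    (hH : 1 ≤ H) (K : Submodule ℂ (Fin b → ℂ)) (hK : ∀ X ∈ V, ∀ y : Fin b → ℂ, X ^ (H - 1) *ᵥ y ∈ K)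
    {A : Matrix (Fin b) (Fin b) ℂ} (hA : A ∈ V) (y₀ : Fin b → ℂ)
    (hC : ∀ w ∈ K, ∃ (c : ℂ) (X : Matrix (Fin b) (Fin b) ℂ), X ∈ V ∧
      w = c • (A ^ (H - 1) *ᵥ y₀) + X *ᵥ (A ^ (H - 1) *ᵥ y₀)) :
    ∀ X ∈ V, X *ᵥ (A ^ (H - 1) *ᵥ y₀) = 0 := by
  intro X hX
  obtain ⟨z, hzK, hz⟩ := exists_mem_mulVec_top_eq V hV hH K hK hA hX y₀
  obtain ⟨z', hz'⟩ := exists_eq_pow_mulVec_of_topSpan_le V hV hH K hK hA y₀ hC (H - 1) le_rfl z hzK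
  rw [hz, hz', Matrix.mulVec_mulVec, ← pow_succ', show H - 1 + 1 = H from by omega, hV A hA, Matrix.zero_mulVec]

/-- ★★ **IRREDUCIBLE FORM** (the habitat of (c), V34 §2): if the values of `V` have NO common invariant subspace other than `⊥`, `⊤`
and `b ≥ 2`, then for every `K` containing all top images and every NONZERO top vector `x = A^{H−1} y₀` (`A ∈ V`), condition (C)
FAILS: some `w ∈ K` is not of the form `c·x + X·x` (`X ∈ V`). [cite: deSeguinsPazzis2019StructuredGerstenhaberII, Lemma 2.5] -/
theorem not_topSpan_le_of_irreducible (V : Submodule ℂ (Matrix (Fin b) (Fin b) ℂ)) {H : ℕ} (hV : ∀ X ∈ V, X ^ H = 0)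
    (hH : 1 ≤ H) (K : Submodule ℂ (Fin b → ℂ)) (hK : ∀ X ∈ V, ∀ y : Fin b → ℂ, X ^ (H - 1) *ᵥ y ∈ K)
    (hirr : ∀ U : Submodule ℂ (Fin b → ℂ), (∀ X ∈ V, ∀ w ∈ U, X *ᵥ w ∈ U) → U = ⊥ ∨ U = ⊤) (hb : 2 ≤ b)
    {A : Matrix (Fin b) (Fin b) ℂ} (hA : A ∈ V) (y₀ : Fin b → ℂ) (hx : A ^ (H - 1) *ᵥ y₀ ≠ 0) :
    ∃ w ∈ K, ∀ (c : ℂ) (X : Matrix (Fin b) (Fin b) ℂ), X ∈ V → w ≠ c • (A ^ (H - 1) *ᵥ y₀) + X *ᵥ (A ^ (H - 1) *ᵥ y₀) := by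
  by_contra hcon
  push Not at hcon
  have hC : ∀ w ∈ K, ∃ (c : ℂ) (X : Matrix (Fin b) (Fin b) ℂ), X ∈ V ∧
      w = c • (A ^ (H - 1) *ᵥ y₀) + X *ᵥ (A ^ (H - 1) *ᵥ y₀) := by
    intro w hw
    obtain ⟨c, X, hX, h⟩ := hcon w hw
    exact ⟨c, X, hX, h⟩
  have h0 := mulVec_top_eq_zero_of_topSpan_le V hV hH K hK hA y₀ hC
  set x := A ^ (H - 1) *ᵥ y₀ with hxdef
  have hU : ∀ X ∈ V, ∀ w ∈ (ℂ ∙ x), X *ᵥ w ∈ (ℂ ∙ x) := by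
    intro X hX w hw
    obtain ⟨c, rfl⟩ := Submodule.mem_span_singleton.mp hw
    rw [Matrix.mulVec_smul, h0 X hX, smul_zero]
    exact Submodule.zero_mem _
  rcases hirr _ hU with hbot | htop
  · apply hx
    have hmem := Submodule.mem_span_singleton_self (R := ℂ) x
    rw [hbot, Submodule.mem_bot] at hmem
    exact hmem
  · have h1 : Module.finrank ℂ (ℂ ∙ x) = 1 := finrank_span_singleton hx
    rw [htop, finrank_top, Module.finrank_fin_fun] at h1
    omega

/-! ## §4 Unconditional corollary (`K = ⊤`): a top vector never generates

(Append, same hand.)  Taking `K = ℂ^b` in the Reducibility Lemma: for EVERY nilpotent space `V ≤ M_b(ℂ)` of uniform index `≤ H`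
(`1 ≤ H`, `b ≥ 2`), every `A ∈ V` and every top vector `x = A^{H−1} y₀`, the subspace `ℂx + V·x` is PROPER — no top vector is a
cyclic generator for `V` (irreducible or not). -/

/-- ★★ **A TOP VECTOR NEVER GENERATES.**  In a nilpotent space `V ≤ M_b(ℂ)` of uniform index `≤ H` (`1 ≤ H`, `2 ≤ b`), for every `A ∈ V`
and `y₀`: some `w ∈ ℂ^b` is not of the form `c·(A^{H−1} y₀) + X·(A^{H−1} y₀)` with `X ∈ V`, i.e. `ℂx + V·x ≠ ℂ^b` for the top vector
`x = A^{H−1} y₀`. [cite: deSeguinsPazzis2019StructuredGerstenhaberII, Lemma 2.5] -/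
theorem exists_not_mem_top_vector_orbit (V : Submodule ℂ (Matrix (Fin b) (Fin b) ℂ)) {H : ℕ} (hV : ∀ X ∈ V, X ^ H = 0)
    (hH : 1 ≤ H) (hb : 2 ≤ b) {A : Matrix (Fin b) (Fin b) ℂ} (hA : A ∈ V) (y₀ : Fin b → ℂ) :
    ∃ w : Fin b → ℂ, ∀ (c : ℂ) (X : Matrix (Fin b) (Fin b) ℂ), X ∈ V →
      w ≠ c • (A ^ (H - 1) *ᵥ y₀) + X *ᵥ (A ^ (H - 1) *ᵥ y₀) := by
  by_contra hcon
  push Not at hcon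
  have hC : ∀ w ∈ (⊤ : Submodule ℂ (Fin b → ℂ)), ∃ (c : ℂ) (X : Matrix (Fin b) (Fin b) ℂ), X ∈ V ∧
      w = c • (A ^ (H - 1) *ᵥ y₀) + X *ᵥ (A ^ (H - 1) *ᵥ y₀) := by
    intro w _
    obtain ⟨c, X, hX, h⟩ := hcon w
    exact ⟨c, X, hX, h⟩
  have h0 := mulVec_top_eq_zero_of_topSpan_le V hV hH ⊤ (fun _ _ _ => Submodule.mem_top) hA y₀ hC
  set x := A ^ (H - 1) *ᵥ y₀ with hxdef
  -- every vector is a multiple of `x`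
  have hall : ∀ w : Fin b → ℂ, w ∈ (ℂ ∙ x) := by
    intro w
    obtain ⟨c, X, hX, h⟩ := hcon w
    rw [h, h0 X hX, add_zero]
    exact Submodule.mem_span_singleton.mpr ⟨c, rfl⟩
  by_cases hx : x = 0
  · have h1 := hall (Pi.single ⟨0, by omega⟩ 1)
    rw [hx, Submodule.mem_span_singleton] at h1
    obtain ⟨c, hc⟩ := h1
    have := congr_fun hc ⟨0, by omega⟩
    simp at this
  · have h1 : Module.finrank ℂ (ℂ ∙ x) = 1 := finrank_span_singleton hx
    have h2 : (⊤ : Submodule ℂ (Fin b → ℂ)) ≤ (ℂ ∙ x) := fun w _ => hall w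
    have h3 := Submodule.finrank_mono h2
    rw [finrank_top, Module.finrank_fin_fun, h1] at h3
    omega

/-! ## §5 Quantitative form of the top-span law: the orbit of a top vector is thinner than the top span

(Append, same hand.)  `V·x ⊆ A·K` (✓ `exists_mem_mulVec_top_eq`) for a top vector `x = A^{H−1} y₀` and any `K` containing all top
images; since `x ∈ K ∩ ker A`, rank–nullity for `A|_K` gives `dim span(V·x) + 1 ≤ dim K` whenever `x ≠ 0`. -/

/-- The orbit span of a top vector lies in `A·K`. [cite: deSeguinsPazzis2019StructuredGerstenhaberII, Prop. 2.2] -/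
theorem span_orbit_top_le_map (V : Submodule ℂ (Matrix (Fin b) (Fin b) ℂ)) {H : ℕ} (hV : ∀ X ∈ V, X ^ H = 0) (hH : 1 ≤ H)
    (K : Submodule ℂ (Fin b → ℂ)) (hK : ∀ X ∈ V, ∀ y : Fin b → ℂ, X ^ (H - 1) *ᵥ y ∈ K)
    {A : Matrix (Fin b) (Fin b) ℂ} (hA : A ∈ V) (y₀ : Fin b → ℂ) :
    Submodule.span ℂ ((fun X : Matrix (Fin b) (Fin b) ℂ => X *ᵥ (A ^ (H - 1) *ᵥ y₀)) '' (V : Set (Matrix (Fin b) (Fin b) ℂ)))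
      ≤ K.map (Matrix.mulVecLin A) := by
  rw [Submodule.span_le]
  rintro _ ⟨X, hX, rfl⟩
  obtain ⟨z, hzK, hz⟩ := exists_mem_mulVec_top_eq V hV hH K hK hA hX y₀
  exact ⟨z, hzK, by rw [Matrix.mulVecLin_apply, ← hz]⟩

/-- ★★ **THE ORBIT OF A TOP VECTOR IS THINNER THAN THE TOP SPAN**: for a NONZERO top vector `x = A^{H−1} y₀` (`A ∈ V`) and every `K`
containing all top images, `dim span(V·x) + 1 ≤ dim K`. [cite: deSeguinsPazzis2019StructuredGerstenhaberII, Prop. 2.2] -/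
theorem finrank_span_orbit_top_lt (V : Submodule ℂ (Matrix (Fin b) (Fin b) ℂ)) {H : ℕ} (hV : ∀ X ∈ V, X ^ H = 0) (hH : 1 ≤ H)
    (K : Submodule ℂ (Fin b → ℂ)) (hK : ∀ X ∈ V, ∀ y : Fin b → ℂ, X ^ (H - 1) *ᵥ y ∈ K)
    {A : Matrix (Fin b) (Fin b) ℂ} (hA : A ∈ V) (y₀ : Fin b → ℂ) (hx : A ^ (H - 1) *ᵥ y₀ ≠ 0) :
    Module.finrank ℂ (Submodule.span ℂ
        ((fun X : Matrix (Fin b) (Fin b) ℂ => X *ᵥ (A ^ (H - 1) *ᵥ y₀)) '' (V : Set (Matrix (Fin b) (Fin b) ℂ)))) + 1 ≤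
      Module.finrank ℂ K := by
  set f : K →ₗ[ℂ] (Fin b → ℂ) := (Matrix.mulVecLin A).domRestrict K with hf
  have hrange : LinearMap.range f = K.map (Matrix.mulVecLin A) := LinearMap.range_domRestrict K _
  have h1 := Submodule.finrank_mono (span_orbit_top_le_map V hV hH K hK hA y₀)
  rw [← hrange] at h1
  have h2 := LinearMap.finrank_range_add_finrank_ker f
  -- the top vector itself is a nonzero element of `ker f`
  have hxK : A ^ (H - 1) *ᵥ y₀ ∈ K := hK A hA y₀
  have hker : (⟨A ^ (H - 1) *ᵥ y₀, hxK⟩ : K) ∈ LinearMap.ker f := by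
    rw [LinearMap.mem_ker, hf, LinearMap.domRestrict_apply, Matrix.mulVecLin_apply, Matrix.mulVec_mulVec, ← pow_succ',
      show H - 1 + 1 = H from by omega, hV A hA, Matrix.zero_mulVec]
  have hne : LinearMap.ker f ≠ ⊥ := by
    intro hbot
    rw [hbot, Submodule.mem_bot] at hker
    exact hx (congrArg Subtype.val hker)
  have h3 : 1 ≤ Module.finrank ℂ (LinearMap.ker f) := Submodule.one_le_finrank_iff.mpr hne
  omega

end Summit.ValiantsHypothesis.ValiantsHypothesis.Theorems.GrenetZeon.NilSpaceTopImage

end
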